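import Summits.QuantumAdvantage.QuantumAdvantage.Theorems.AvgFaceBeyondPrior.Negative.AvgFaceBeyondPriorTransfer
import Summits.QuantumAdvantage.QuantumAdvantage.Theorems.AvgFaceBeyondPrior.Negative.AvgFaceBeyondPriorBlocks
import Literature.NumberTheory.QuadraticFields.ThreeTorsion
import Literature.NumberTheory.QuadraticFields.ThreeTorsionMean
import Literature.NumberTheory.QuadraticFields.ThreeTorsionMeanProofs

/-!
# The `δ`-ceiling of the crux `ArithStatLadder.AvgFaceBeyondPrior` (stmt-QuantumAdvantage-2427): Davenport–Heilbronn puts it at `1/2`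

Helper file of the crux (line lead, 2026-08-16). The crux is the `δ = 1/3` member of the antitone family
`(IQ3, U) ∉ Heur_δBPP` (`Negative.Q ∉ HeurDeltaBPP (fun _ => δ)`; `IQ3 = {bin d : −d fundamental, 3 ∣ h(−d)}`,
`Uₙ` uniform on the n-bit `d` with `−d` fundamental). Landed so far on the `δ`-axis: the family is trivially
true for `δ < 0` and false at `δ = 1` (`Negative.not_mem_HeurDeltaBPP_of_neg`,
`Negative.avgFaceBeyondPrior_false_at_delta_one`), and false at `δ` as soon as, from some level on, at most
a `δ`-fraction of every dyadic block has `3 ∣ h(−d)` (`Negative.mem_HeurDeltaBPP_of_density`: the constant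
predictor `3 ∤ h`, patched below that level).

This file proves the arithmetic input of the last criterion from the **Davenport–Heilbronn theorem** (named
fact `Literature.NumberTheory.QuadraticFields.bst_threeTorsion_mean`, Bhargava–Shankar–Tsimerman Cor. 7:
the mean of `#Cl₃(D)` over the imaginary quadratic fields with `|D| < X` tends to `2`) and concludes:

* `card_three_dvd_le_of_dh` — given DH, for every `ε > 0`, eventually in `n`, at most a `(1/2 + ε)`-fraction
  of the n-bit fundamental `−d` have `3 ∣ h(−d)` (Markov on `#Cl₃ = 3^{r₃} ≥ 1 + 2·𝟙[3 ∣ h]`, after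
  transporting the mean `2` from initial segments to dyadic blocks with the PROVED count
  `abs_card_negFundDiscrs_sub_le`);
* `mem_HeurDeltaBPP_half_add_of_dh` — **given DH, `(IQ3, U) ∈ Heur_{1/2+ε}BPP` for every `ε > 0`**: the
  strengthening of the crux to any `δ > 1/2` is FALSE (conditionally on a printed theorem whose formal
  proof road `CubicFields/*` is in progress). So the live interval for `δ` is `[1/3, 1/2]`; Cohen–Lenstra's
  heuristic (C2) puts the flip at `1 − ∏_{i≥1}(1 − 3^{−i}) = 0.43987`.

The block↔window transport (`fundBlock_image_neg` … `windowMean_of_dh`) is adapted from the checked line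
skeleton `Cruxes/AvgFaceBeyondPrior/Lines/cubic_discriminant_pseudorandomness.lean` (planner
cruxplan-…-cubic-discriminant-p-0), re-typed over the landed `Negative.fundBlock`.

References: H. Davenport, H. Heilbronn, Proc. Roy. Soc. A 322 (1971), Thm. 3; M. Bhargava, A. Shankar,
J. Tsimerman, Invent. Math. 193 (2013), Cor. 7; H. Cohen, H. W. Lenstra, LNM 1068 (1984), §9 (C2);
A. Bogdanov, L. Trevisan, Found. Trends TCS 2 (2006), Def. 2.13.
-/

set_option linter.dupNamespace false -- D-0017: single-problem summit ⇒ `QuantumAdvantage.QuantumAdvantage` by design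

noncomputable section

namespace Summit.QuantumAdvantage.QuantumAdvantage.Theorems.AvgFaceBeyondPrior.DeltaCeiling

open Filter Finset
open scoped Topology Classical
open _root_.Computability Literature.Computability.Complexity Literature.Computability.MetaComplexity
open Literature.NumberTheory.QuadraticFields
open Summit.QuantumAdvantage.QuantumAdvantage.Theorems.AvgFaceBeyondPrior
open Summit.QuantumAdvantage.QuantumAdvantage.Theses.ArithStatLadder

/-! ## §1 Transport: dyadic blocks of `d` versus windows of `D = −d` -/

/-- `d ↦ −d : ℕ → ℤ` is injective. [folklore] -/
theorem neg_natCast_injective : Function.Injective (fun d : ℕ => -(d:ℤ)) := fun a b h => by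
  have h' : (a:ℤ) = (b:ℤ) := neg_inj.1 h
  exact_mod_cast h'

/-- **Reindexing**: `d ↦ −d` maps the dyadic block `Negative.fundBlock n` onto the window
`negFundDiscrs (2^n) ∖ negFundDiscrs (2^(n−1))` (`−2^n < D ≤ −2^(n−1) ⟺ 2^(n−1) ≤ d < 2^n`). [folklore] -/
theorem fundBlock_image_neg (n : ℕ) :
    (Negative.fundBlock n).image (fun d : ℕ => -(d:ℤ)) =
      negFundDiscrs (2 ^ n) \ negFundDiscrs (2 ^ (n - 1)) := by
  ext D
  simp only [Finset.mem_image, Finset.mem_sdiff, mem_negFundDiscrs, Negative.fundBlock, Finset.mem_filter,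
    Finset.mem_Ico]
  constructor
  · rintro ⟨d, ⟨⟨h1, h2⟩, hP⟩, rfl⟩
    have hpos := Nat.two_pow_pos (n - 1)
    refine ⟨⟨⟨by omega, by omega⟩, hP⟩, ?_⟩
    rintro ⟨⟨h3, -⟩, -⟩
    omega
  · rintro ⟨⟨⟨h1, h2⟩, hQ⟩, hnot⟩
    obtain ⟨d, rfl⟩ : ∃ d : ℕ, D = -(d:ℤ) := ⟨D.natAbs, by omega⟩
    refine ⟨d, ⟨⟨?_, by omega⟩, hQ⟩, rfl⟩
    by_contra hlt
    exact hnot ⟨⟨by omega, h2⟩, hQ⟩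

/-- `negFundDiscrs` is monotone in `X`. [folklore] -/
theorem negFundDiscrs_mono {X Y : ℕ} (h : X ≤ Y) : negFundDiscrs X ⊆ negFundDiscrs Y := by
  intro D hD
  rw [mem_negFundDiscrs] at hD ⊢
  exact ⟨⟨by omega, hD.1.2⟩, hD.2⟩

/-- The block sum of `#Cl₃(−d)` is a difference of two initial sums. [folklore] -/
theorem sum_fundBlock_eq (n : ℕ) :
    (∑ d ∈ Negative.fundBlock n, (quadFieldThreeTorsion (-(d:ℤ)) : ℝ)) =
      (∑ D ∈ negFundDiscrs (2 ^ n), (quadFieldThreeTorsion D : ℝ)) -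
        ∑ D ∈ negFundDiscrs (2 ^ (n - 1)), (quadFieldThreeTorsion D : ℝ) := by
  have hsub : negFundDiscrs (2 ^ (n - 1)) ⊆ negFundDiscrs (2 ^ n) :=
    negFundDiscrs_mono (Nat.pow_le_pow_right (by norm_num) (Nat.sub_le n 1))
  rw [← Finset.sum_sdiff hsub, add_sub_cancel_right, ← fundBlock_image_neg,
    Finset.sum_image fun a _ b _ h => neg_natCast_injective h]

/-- The block count is a difference of two initial counts. [folklore] -/
theorem card_fundBlock_eq (n : ℕ) :
    ((Negative.fundBlock n).card : ℝ) =
      ((negFundDiscrs (2 ^ n)).card : ℝ) - ((negFundDiscrs (2 ^ (n - 1))).card : ℝ) := by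
  have hsub : negFundDiscrs (2 ^ (n - 1)) ⊆ negFundDiscrs (2 ^ n) :=
    negFundDiscrs_mono (Nat.pow_le_pow_right (by norm_num) (Nat.sub_le n 1))
  have h := Finset.card_sdiff_add_card_eq_card hsub
  rw [← fundBlock_image_neg, Finset.card_image_of_injective _ neg_natCast_injective] at h
  have h' := congrArg (fun k : ℕ => (k : ℝ)) h
  push_cast at h'
  linarith

/-- Pure-real core of the differencing: `|S₁/N₁ − 2| ≤ e₁`, `|S₀/N₀ − 2| ≤ e₀`, `N₁ ≤ 8(N₁ − N₀)`,
`N₀ ≤ 4(N₁ − N₀)` give `|(S₁ − S₀)/(N₁ − N₀) − 2| ≤ 8e₁ + 4e₀`. [folklore] -/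
theorem ratio_core {N1 N0 S1 S0 e1 e0 : ℝ} (hD : 0 < N1 - N0) (hN0 : 0 < N0)
    (hN1 : N1 ≤ 8 * (N1 - N0)) (hN0' : N0 ≤ 4 * (N1 - N0))
    (h1 : |S1 / N1 - 2| ≤ e1) (h0 : |S0 / N0 - 2| ≤ e0) :
    |(S1 - S0) / (N1 - N0) - 2| ≤ 8 * e1 + 4 * e0 := by
  have hN1pos : 0 < N1 := by linarith
  have he1 : 0 ≤ e1 := (abs_nonneg _).trans h1
  have he0 : 0 ≤ e0 := (abs_nonneg _).trans h0
  have q1 : (S1 - 2 * N1) / N1 = S1 / N1 - 2 := by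
    rw [sub_div, mul_div_cancel_right₀ _ hN1pos.ne']
  have q0 : (S0 - 2 * N0) / N0 = S0 / N0 - 2 := by
    rw [sub_div, mul_div_cancel_right₀ _ hN0.ne']
  have q : ((S1 - 2 * N1) - (S0 - 2 * N0)) / (N1 - N0) = (S1 - S0) / (N1 - N0) - 2 := by
    rw [show (S1 - 2 * N1) - (S0 - 2 * N0) = (S1 - S0) - 2 * (N1 - N0) by ring, sub_div,
      mul_div_cancel_right₀ _ hD.ne']
  have hA : |S1 - 2 * N1| ≤ e1 * N1 := by
    rw [← q1, abs_div, abs_of_pos hN1pos, div_le_iff₀ hN1pos] at h1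
    exact h1
  have hB : |S0 - 2 * N0| ≤ e0 * N0 := by
    rw [← q0, abs_div, abs_of_pos hN0, div_le_iff₀ hN0] at h0
    exact h0
  rw [← q, abs_div, abs_of_pos hD, div_le_iff₀ hD]
  calc |S1 - 2 * N1 - (S0 - 2 * N0)| ≤ |S1 - 2 * N1| + |S0 - 2 * N0| := abs_sub _ _
    _ ≤ e1 * N1 + e0 * N0 := add_le_add hA hB
    _ ≤ e1 * (8 * (N1 - N0)) + e0 * (4 * (N1 - N0)) :=
        add_le_add (mul_le_mul_of_nonneg_left hN1 he1) (mul_le_mul_of_nonneg_left hN0' he0)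
    _ = (8 * e1 + 4 * e0) * (N1 - N0) := by ring

/-- Pure-real consequence of the count `N(X) = cX + O(√X)` on a dyadic window `[X, 2X)`, once
`X ≥ (64/c)²`: `0 < N₀`, `0 < N₁ − N₀`, `N₁ ≤ 8(N₁ − N₀)`, `N₀ ≤ 4(N₁ − N₀)`. [folklore] -/
theorem count_window {c X N1 N0 : ℝ} (hc : 0 < c) (hX : (64 / c) ^ 2 ≤ X)
    (hN1 : |N1 - c * (2 * X)| ≤ 8 * Real.sqrt (2 * X)) (hN0 : |N0 - c * X| ≤ 8 * Real.sqrt X) :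
    0 < N1 - N0 ∧ 0 < N0 ∧ N1 ≤ 8 * (N1 - N0) ∧ N0 ≤ 4 * (N1 - N0) := by
  have h64 : (0:ℝ) < 64 / c := by positivity
  have hXpos : 0 < X := lt_of_lt_of_le (by positivity) hX
  have hsx : 64 / c ≤ Real.sqrt X := by
    rw [← Real.sqrt_sq h64.le]
    exact Real.sqrt_le_sqrt hX
  have hsqX : Real.sqrt X * Real.sqrt X = X := Real.mul_self_sqrt hXpos.le
  have h32 : 32 * Real.sqrt X ≤ c / 2 * X := by
    have : c / 2 * X = (c / 2 * Real.sqrt X) * Real.sqrt X := by rw [mul_assoc, hsqX]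
    rw [this]
    have h2 : (32:ℝ) ≤ c / 2 * Real.sqrt X := by
      have := mul_le_mul_of_nonneg_left hsx (by positivity : (0:ℝ) ≤ c / 2)
      calc (32:ℝ) = c / 2 * (64 / c) := by field_simp; ring
        _ ≤ c / 2 * Real.sqrt X := this
    exact mul_le_mul_of_nonneg_right h2 (Real.sqrt_nonneg X)
  have hs2 : Real.sqrt (2 * X) ≤ 2 * Real.sqrt X := by
    have h4 : Real.sqrt (4 * X) = 2 * Real.sqrt X := by
      rw [Real.sqrt_mul (by norm_num : (0:ℝ) ≤ 4), show (4:ℝ) = 2 ^ 2 by norm_num,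
        Real.sqrt_sq (by norm_num : (0:ℝ) ≤ 2)]
    rw [← h4]
    exact Real.sqrt_le_sqrt (by linarith)
  have a1 := (abs_le.1 hN1).1
  have a2 := (abs_le.1 hN1).2
  have b1 := (abs_le.1 hN0).1
  have b2 := (abs_le.1 hN0).2
  have hsnn := Real.sqrt_nonneg X
  have hcX : 0 < c * X := mul_pos hc hXpos
  refine ⟨by nlinarith, by nlinarith, by nlinarith, by nlinarith⟩

/-- **Davenport–Heilbronn on dyadic blocks from the plain mean**: if the mean of `#Cl₃(D)` over
`−X < D < 0` tends to `2`, then so does its mean over the blocks `Negative.fundBlock n` (differencing along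
`X = 2^m, 2^{m+1}` with the PROVED count `abs_card_negFundDiscrs_sub_le`, `N(X) = (3/π²)X + O(√X)`).
[cite: DavenportHeilbronn1971, Thm 3] -/
theorem windowMean_of_dh
    (h : Tendsto (fun X : ℕ =>
      (∑ D ∈ negFundDiscrs X, (quadFieldThreeTorsion D : ℝ)) / ((negFundDiscrs X).card : ℝ)) atTop (𝓝 2)) :
    Tendsto (fun n : ℕ => (∑ d ∈ Negative.fundBlock n, (quadFieldThreeTorsion (-(d:ℤ)) : ℝ)) /
      ((Negative.fundBlock n).card : ℝ)) atTop (𝓝 2) := by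
  -- name the two sequences `S(X) = Σ_{|D|<X} #Cl₃(D)` and `C(X) = #{|D| < X}`
  obtain ⟨S, hS⟩ : ∃ S : ℕ → ℝ, ∀ X, S X = ∑ D ∈ negFundDiscrs X, (quadFieldThreeTorsion D : ℝ) :=
    ⟨_, fun _ => rfl⟩
  obtain ⟨C, hC⟩ : ∃ C : ℕ → ℝ, ∀ X, C X = ((negFundDiscrs X).card : ℝ) := ⟨_, fun _ => rfl⟩
  have hmean : Tendsto (fun X : ℕ => S X / C X) atTop (𝓝 2) := by
    simp only [hS, hC]; exact h
  have hcount : ∀ X : ℕ, |C X - 3 / Real.pi ^ 2 * X| ≤ 8 * Real.sqrt X := fun X => by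
    rw [hC]; exact abs_card_negFundDiscrs_sub_le X
  have hc : (0:ℝ) < 3 / Real.pi ^ 2 := by positivity
  have hpow : Tendsto (fun m : ℕ => 2 ^ m) atTop atTop :=
    tendsto_pow_atTop_atTop_of_one_lt (by norm_num : (1:ℕ) < 2)
  have h1 : Tendsto (fun m : ℕ => S (2 ^ (m + 1)) / C (2 ^ (m + 1))) atTop (𝓝 2) :=
    hmean.comp (hpow.comp (tendsto_add_atTop_nat 1))
  have h0 : Tendsto (fun m : ℕ => S (2 ^ m) / C (2 ^ m)) atTop (𝓝 2) := hmean.comp hpow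
  have hreal : Tendsto (fun m : ℕ => ((2 ^ m : ℕ) : ℝ)) atTop atTop := by
    have := tendsto_pow_atTop_atTop_of_one_lt (by norm_num : (1:ℝ) < 2)
    refine this.congr' (Filter.Eventually.of_forall fun m => ?_)
    simp
  rw [Metric.tendsto_atTop]
  intro ε hε
  obtain ⟨m₁, hm₁⟩ := Metric.tendsto_atTop.1 h1 (ε / 16) (by positivity)
  obtain ⟨m₀, hm₀⟩ := Metric.tendsto_atTop.1 h0 (ε / 16) (by positivity)
  obtain ⟨m₂, hm₂⟩ := Filter.eventually_atTop.1 (Filter.tendsto_atTop.1 hreal ((64 / (3 / Real.pi ^ 2)) ^ 2))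
  refine ⟨m₁ + m₀ + m₂ + 1, fun n hn => ?_⟩
  obtain ⟨m, rfl⟩ : ∃ m, n = m + 1 := ⟨n - 1, by omega⟩
  have hm1 := hm₁ m (by omega)
  have hm0 := hm₀ m (by omega)
  have hm2 := hm₂ m (by omega)
  beta_reduce at hm1 hm0 ⊢
  rw [Real.dist_eq] at hm1 hm0 ⊢
  rw [sum_fundBlock_eq, card_fundBlock_eq, ← hS, ← hS, ← hC, ← hC]
  simp only [Nat.add_sub_cancel]
  have h2X : ((2 ^ (m + 1) : ℕ) : ℝ) = 2 * ((2 ^ m : ℕ) : ℝ) := by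
    push_cast; ring
  have hN1 : |C (2 ^ (m + 1)) - 3 / Real.pi ^ 2 * (2 * ((2 ^ m : ℕ) : ℝ))|
      ≤ 8 * Real.sqrt (2 * ((2 ^ m : ℕ) : ℝ)) := by
    have := hcount (2 ^ (m + 1)); rwa [h2X] at this
  have hN0 : |C (2 ^ m) - 3 / Real.pi ^ 2 * ((2 ^ m : ℕ) : ℝ)| ≤ 8 * Real.sqrt ((2 ^ m : ℕ) : ℝ) :=
    hcount (2 ^ m)
  obtain ⟨hD, hN0pos, hN1le, hN0le⟩ := count_window hc hm2 hN1 hN0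
  have key := ratio_core hD hN0pos hN1le hN0le hm1.le hm0.le
  linarith

/-! ## §2 Markov: at most half of a block can carry nontrivial `3`-torsion when the mean is `2` -/

/-- **Pointwise**: `1 + 2·𝟙[1 < #Cl₃(−d)] ≤ #Cl₃(−d)`, since `#Cl₃ = 3^{r₃}` is `1` or at least `3`
(`exists_quadFieldThreeTorsion_eq_pow`). [folklore] -/
theorem one_add_two_mul_indicator_le (d : ℕ) :
    1 + 2 * (if 1 < quadFieldThreeTorsion (-(d:ℤ)) then (1:ℝ) else 0) ≤
      (quadFieldThreeTorsion (-(d:ℤ)) : ℝ) := by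
  obtain ⟨r, hr⟩ := exists_quadFieldThreeTorsion_eq_pow (-(d:ℤ))
  rw [hr]
  rcases r with _ | r
  · norm_num
  · have hlt : 1 < 3 ^ (r + 1) := Nat.one_lt_pow (by omega) (by norm_num)
    rw [if_pos hlt]
    have h3 : (3:ℝ) ≤ ((3 ^ (r + 1) : ℕ) : ℝ) := by
      have : 3 ^ 1 ≤ 3 ^ (r + 1) := Nat.pow_le_pow_right (by norm_num) (by omega)
      exact_mod_cast this
    linarith

/-- **Markov on a finite set of `d`'s**: `#S + 2·#{d ∈ S : 1 < #Cl₃(−d)} ≤ Σ_{d ∈ S} #Cl₃(−d)`.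
[folklore] -/
theorem card_add_two_mul_card_filter_le (S : Finset ℕ) :
    (S.card : ℝ) + 2 * ((S.filter fun d : ℕ => 1 < quadFieldThreeTorsion (-(d:ℤ))).card : ℝ) ≤
      ∑ d ∈ S, (quadFieldThreeTorsion (-(d:ℤ)) : ℝ) := by
  have hcard : ((S.filter fun d : ℕ => 1 < quadFieldThreeTorsion (-(d:ℤ))).card : ℝ)
      = ∑ d ∈ S, (if 1 < quadFieldThreeTorsion (-(d:ℤ)) then (1:ℝ) else 0) := by
    rw [Finset.sum_ite, Finset.sum_const_zero, add_zero, Finset.sum_const, nsmul_eq_mul, mul_one]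
  have hS : (S.card : ℝ) = ∑ d ∈ S, (1:ℝ) := by
    rw [Finset.sum_const, nsmul_eq_mul, mul_one]
  rw [hcard, hS, Finset.mul_sum, ← Finset.sum_add_distrib]
  exact Finset.sum_le_sum fun d _ => one_add_two_mul_indicator_le d

/-- On a block, `3 ∣ h(−d)` is `1 < #Cl₃(−d)` (`three_dvd_classNumber_iff_one_lt_quadFieldThreeTorsion`,
form class number = `h(ℚ(√−d))`, Cauchy), so the two filters agree. [folklore] -/
theorem filter_three_dvd_eq (n : ℕ) :
    ((Negative.fundBlock n).filter fun d : ℕ => 3 ∣ BinaryQuadraticForm.classNumber (-(d:ℤ))) =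
      (Negative.fundBlock n).filter fun d : ℕ => 1 < quadFieldThreeTorsion (-(d:ℤ)) := by
  refine Finset.filter_congr fun d hd => ?_
  -- the block's filter carries the ROUTE's (classical) `Decidable` instance: take it by unification
  have hd' := (@Finset.mem_filter _ _ (_) _ _).1 hd
  have hIco := Finset.mem_Ico.1 hd'.1
  have hpos : 0 < d := lt_of_lt_of_le (Nat.two_pow_pos (n - 1)) hIco.1
  exact three_dvd_classNumber_iff_one_lt_quadFieldThreeTorsion hd'.2 (by omega)

/-! ## §3 The ceiling -/

/-- **Given Davenport–Heilbronn, at most `(1/2 + ε)` of every late block has `3 ∣ h(−d)`**: for every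
`ε > 0`, eventually in `n`, `#{d ∈ 𝒟ₙ : 3 ∣ h(−d)} ≤ (1/2 + ε)·#𝒟ₙ` (`𝒟ₙ = Negative.fundBlock n`).
From the block mean `→ 2` (`windowMean_of_dh`) and Markov (`card_add_two_mul_card_filter_le`).
[cite: DavenportHeilbronn1971, Thm 3] -/
theorem card_three_dvd_le_of_dh (hDH : bst_threeTorsion_mean) {ε : ℝ} (hε : 0 < ε) :
    ∀ᶠ n : ℕ in atTop,
      ((((Negative.fundBlock n).filter fun d : ℕ =>
          3 ∣ BinaryQuadraticForm.classNumber (-(d:ℤ))).card : ℝ))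
        ≤ (1 / 2 + ε) * ((Negative.fundBlock n).card : ℝ) := by
  have hW := windowMean_of_dh hDH.neg
  have hev := (Metric.tendsto_atTop.1 hW) (2 * ε) (by positivity)
  obtain ⟨n₁, hn₁⟩ := hev
  refine Filter.eventually_atTop.2 ⟨max n₁ 2, fun n hn => ?_⟩
  have hne : (Negative.fundBlock n).Nonempty :=
    Negative.Blocks.fundBlock_nonempty (le_trans (le_max_right _ _) hn)
  have hN : (0:ℝ) < (Negative.fundBlock n).card := by exact_mod_cast hne.card_pos
  have hdist := hn₁ n (le_trans (le_max_left _ _) hn)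
  rw [Real.dist_eq] at hdist
  set S : ℝ := ∑ d ∈ Negative.fundBlock n, (quadFieldThreeTorsion (-(d:ℤ)) : ℝ) with hSdef
  set N : ℝ := ((Negative.fundBlock n).card : ℝ) with hNdef
  -- the block sum is at most `(2 + 2ε)·N`
  have hSle : S ≤ (2 + 2 * ε) * N := by
    have h1 : S / N - 2 < 2 * ε := (abs_lt.1 hdist).2
    have h2 : S / N < 2 + 2 * ε := by linarith
    have h3 := (div_lt_iff₀ hN).1 h2
    linarith
  -- Markov
  have hM := card_add_two_mul_card_filter_le (Negative.fundBlock n)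
  rw [filter_three_dvd_eq]
  rw [← hSdef, ← hNdef] at hM
  nlinarith

/-- **The `δ`-ceiling: given Davenport–Heilbronn, `(IQ3, U) ∈ Heur_{1/2+ε}BPP` for every `ε > 0`** — the
strengthening of the crux `AvgFaceBeyondPrior = (Negative.Q ∉ Heur_{1/3}BPP)` to any `δ > 1/2` is false
(conditionally on the printed theorem `bst_threeTorsion_mean`): the constant predictor "`3 ∤ h`", patched by
a finite table below the level supplied by `card_three_dvd_le_of_dh`, is a PPT heuristic algorithm with bad
`Uₙ`-mass `≤ 1/2 + ε` at every level (`Negative.mem_HeurDeltaBPP_of_density`). Hence any line for the crux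
must use an input separating `δ = 1/3` from `δ = 1/2`; Cohen–Lenstra (C2) predicts the flip at `0.43987`.
[cite: DavenportHeilbronn1971, Thm 3] [cite: BogdanovTrevisan2006, Def. 2.13] [cite: CohenLenstra1984, §9 (C2)] -/
theorem mem_HeurDeltaBPP_half_add_of_dh :
    bst_threeTorsion_mean → ∀ ε : ℝ, 0 < ε → Negative.Q ∈ HeurDeltaBPP (fun _ => 1 / 2 + ε) := by
  intro hDH ε hε
  obtain ⟨N, hN⟩ := Filter.eventually_atTop.1 (card_three_dvd_le_of_dh hDH hε)
  exact Negative.mem_HeurDeltaBPP_of_density N (by positivity) fun n hn => hN n hn.le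

/-- **Corollary (the `δ`-family above `1/2` is refuted, given DH)**: for `δ > 1/2`,
`¬ (Negative.Q ∉ HeurDeltaBPP (fun _ => δ))`. With `Negative.not_mem_HeurDeltaBPP_anti` (the family is
antitone in `δ`) this pins the open range of the crux's constant to `δ ∈ [1/3, 1/2]`.
[cite: DavenportHeilbronn1971, Thm 3] -/
theorem not_strongFace_of_dh (hDH : bst_threeTorsion_mean) {δ : ℝ} (hδ : 1 / 2 < δ) :
    ¬ (Negative.Q ∉ HeurDeltaBPP (fun _ => δ)) := by
  intro h
  have hmem := mem_HeurDeltaBPP_half_add_of_dh hDH (δ - 1 / 2) (by linarith)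
  have heq : (fun _ : ℕ => 1 / 2 + (δ - 1 / 2)) = (fun _ : ℕ => δ) := by
    funext _; ring
  rw [heq] at hmem
  exact h hmem

end Summit.QuantumAdvantage.QuantumAdvantage.Theorems.AvgFaceBeyondPrior.DeltaCeiling

end
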